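import Summits.BirchSwinnertonDyer.BirchSwinnertonDyer.Theorems.CyclotomicUntwistDescendedFrobeniusTransferReduction
import Literature.NumberTheory.EllipticCurves.FormalGroupFrobeniusTypeProofs
import HarnessLib

/-!
# Route `CyclotomicUntwist`: the named fact `isDescendedFrobeniusMatrix_exists` FOLLOWS from the Berthelot–Ogus
# transfer-coordinate statement (existence of `M` with `det M = 3`, `ClassesIndependent`, both power maps and the
# TRACE clause — all derived)

Cell `pub/bsd-wall` (D-0145 line `route-BirchSwinnertonDyer-CyclotomicUntwist`), prover seat `bsd-line-cycu-p2`
(gen 6), lane «D5»; capstone of `…DescendedFrobeniusTransferBasis` / `…TransferReduction`. THEOREMS ONLY (no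
definition, no named fact, no `sorry`); helper `--supports` K1 = stmt-BirchSwinnertonDyer-21580 (serves K2 = 21581 and
the print child C2 = 27549, whose `stub_descendedFrobenius` is closed modulo `isDescendedFrobeniusMatrix_exists`). BSD
is not proved by this file and no crux is.

`isDescendedFrobeniusMatrix_exists_of_transfer`: **IF** for every `W/ℚ`, every good model `𝓜` over `𝓞_{ℚ₃(ζ₉)}`, every
reduction map `ρ : 𝓞 → 𝔽₃` and every `ℤ₃`-lift `V₀` of the special fibre (`V₀ mod 3 = 𝓜.specialFibre ρ`) there is a
rational matrix `M` such that every good model `𝓜′` of `W` has transfer coordinates `(a,b,c,d) ∈ ℚ₃(ζ₉)⁴`,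
`ad − bc ≠ 0`, expressing `𝓜′.classOmega`, `𝓜′.classEta` on `(log_{V₀}(z⁹), log_{V₀}(z²⁷))` modulo bounded denominators
and intertwining `M` with the companion matrix of `X² − aX + 3`, `a = 4 − #Ē(𝔽₃)` — the Berthelot–Ogus comparison
(2.4) on the two Néron classes, in power series — **THEN** `WeierstrassCurve.isDescendedFrobeniusMatrix_exists` holds
(for every good model and reduction map with `3 ∣ a`: some `M` with `IsDescendedFrobeniusMatrix W M` and `tr M = a`).
The supersingular Honda input (`hondaShift 3 a log_{V₀} ∈ ℤ₃⟦z⟧`) is the tree's `norm_coeff_hondaShift_formalLog_le_one`,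
applied to the lift `V₀`, whose fibres are elliptic because the good model has unit discriminant.
[cite: BerthelotOgus1983, Thm. 2.4] [cite: Katz1981CrystallineDieudonne, §5 Thm 5.1.4, Thm 5.3.3] [cite: Honda1970, Thm. 9]
-/

set_option autoImplicit false
-- single-conjunct summit: `Summit.BirchSwinnertonDyer.BirchSwinnertonDyer.…` repeats the name by design
set_option linter.dupNamespace false

noncomputable section

open PowerSeries Literature.RingTheory.FormalGroups Literature.NumberTheory.EllipticCurves
  Literature.NumberTheory.EllipticCurves.DescendedFrobenius WeierstrassCurve

namespace Summit.BirchSwinnertonDyer.BirchSwinnertonDyer.Theorems.DescendedFrobeniusTransfer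

/-- The special fibre of a good model along any reduction map is an elliptic curve over `𝔽₃` (unit discriminant).
[cite: SilvermanAEC2009, VII.5] -/
theorem isElliptic_specialFibre {W : WeierstrassCurve ℚ} (𝓜 : W.NineGoodModel) (ρ : ONine →+* ZMod 3) :
    (𝓜.specialFibre ρ).IsElliptic :=
  ⟨by rw [NineGoodModel.specialFibre, map_Δ]; exact 𝓜.isUnit_Δ.map ρ⟩

/-- A `ℤ₃`-curve whose reduction is elliptic is elliptic over `ℚ₃` (its discriminant is a `3`-adic unit).
[cite: SilvermanAEC2009, VII.5] -/
theorem isElliptic_map_coe_of_map_toZMod {V₀ : WeierstrassCurve ℤ_[3]} (h : (V₀.map PadicInt.toZMod).IsElliptic) :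
    (V₀.map PadicInt.Coe.ringHom).IsElliptic := by
  refine ⟨?_⟩
  rw [map_Δ, isUnit_iff_ne_zero]
  intro h0
  have hΔ : V₀.Δ = 0 := PadicInt.coe_eq_zero.mp h0
  have h1 := h.1
  rw [map_Δ, hΔ, map_zero] at h1
  exact not_isUnit_zero h1

/-- `HasseManin.tr` of a curve over `𝔽₃` is `4 − #Ē(𝔽₃)` = the `specialFibreTrace` of the Literature file. [folklore] -/
theorem tr_eq_specialFibreTrace {W : WeierstrassCurve ℚ} (𝓜 : W.NineGoodModel) (ρ : ONine →+* ZMod 3)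
    {V₀ : WeierstrassCurve ℤ_[3]} (hV : V₀.map PadicInt.toZMod = 𝓜.specialFibre ρ) :
    HasseManin.tr (V₀.map PadicInt.toZMod) = 𝓜.specialFibreTrace ρ := by
  rw [HasseManin.tr, NineGoodModel.specialFibreTrace, hV, ZMod.card]
  norm_num

/-- **Lifting the special fibre to `ℤ₃`**: every reduction `𝓜.specialFibre ρ` is `V₀ mod 3` for some `V₀/ℤ₃`
(lift the five coefficients). [folklore] -/
theorem exists_lift_specialFibre {W : WeierstrassCurve ℚ} (𝓜 : W.NineGoodModel) (ρ : ONine →+* ZMod 3) :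
    ∃ V₀ : WeierstrassCurve ℤ_[3], V₀.map PadicInt.toZMod = 𝓜.specialFibre ρ := by
  set F := 𝓜.specialFibre ρ with hF
  refine ⟨⟨(F.a₁.val : ℤ_[3]), (F.a₂.val : ℤ_[3]), (F.a₃.val : ℤ_[3]), (F.a₄.val : ℤ_[3]), (F.a₆.val : ℤ_[3])⟩, ?_⟩
  ext <;> simp [WeierstrassCurve.map]

/-- **`isDescendedFrobeniusMatrix_exists` ⟸ TRANSFER COORDINATES.** See the module docstring: the hypothesis is the
Berthelot–Ogus comparison on the two classes `[ω_W], [η_W]` of every good model, against the transfer basis of a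
`ℤ₃`-lift of the special fibre, with one rational intertwined matrix; the conclusion is the Literature named fact
VERBATIM (existence, `det = 3`, independence, power maps, trace). [cite: BerthelotOgus1983, Thm. 2.4]
[cite: Katz1981CrystallineDieudonne, §5 Thm 5.1.4, Thm 5.3.3] [cite: Honda1970, Thm. 9] -/
theorem isDescendedFrobeniusMatrix_exists_of_transfer
    (H : ∀ (W : WeierstrassCurve ℚ) (𝓜 : W.NineGoodModel) (ρ : ONine →+* ZMod 3) (V₀ : WeierstrassCurve ℤ_[3]),
      V₀.map PadicInt.toZMod = 𝓜.specialFibre ρ →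
      ∃ M : Matrix (Fin 2) (Fin 2) ℚ_[3], ∀ 𝓜' : W.NineGoodModel, ∃ a b c d : KNine, a * d - b * c ≠ 0 ∧
        HasBoundedDenominators (𝓜'.classOmega -
          PowerSeries.C a * expand 9 (by norm_num) (((V₀.map PadicInt.Coe.ringHom).formalLog).map (algebraMap ℚ_[3] KNine)) -
          PowerSeries.C b * expand 27 (by norm_num) (((V₀.map PadicInt.Coe.ringHom).formalLog).map (algebraMap ℚ_[3] KNine))) ∧
        HasBoundedDenominators (𝓜'.classEta -
          PowerSeries.C c * expand 9 (by norm_num) (((V₀.map PadicInt.Coe.ringHom).formalLog).map (algebraMap ℚ_[3] KNine)) -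
          PowerSeries.C d * expand 27 (by norm_num) (((V₀.map PadicInt.Coe.ringHom).formalLog).map (algebraMap ℚ_[3] KNine))) ∧
        !![a, c; b, d] * M.map (algebraMap ℚ_[3] KNine) =
          !![0, -3; 1, algebraMap ℚ_[3] KNine ((HasseManin.tr (V₀.map PadicInt.toZMod) : ℤ) : ℚ_[3])] * !![a, c; b, d]) :
    WeierstrassCurve.isDescendedFrobeniusMatrix_exists := by
  intro W 𝓜 ρ hss
  obtain ⟨V₀, hV⟩ := exists_lift_specialFibre 𝓜 ρ
  obtain ⟨M, hM⟩ := H W 𝓜 ρ V₀ hV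
  haveI hEt : (V₀.map PadicInt.toZMod).IsElliptic := by rw [hV]; exact isElliptic_specialFibre 𝓜 ρ
  haveI hE : (V₀.map PadicInt.Coe.ringHom).IsElliptic := isElliptic_map_coe_of_map_toZMod hEt
  have htr : HasseManin.tr (V₀.map PadicInt.toZMod) = 𝓜.specialFibreTrace ρ := tr_eq_specialFibreTrace 𝓜 ρ hV
  have h3t : (3 : ℤ) ∣ HasseManin.tr (V₀.map PadicInt.toZMod) := by rw [htr]; exact hss
  have hT := WeierstrassCurve.norm_coeff_hondaShift_formalLog_le_one V₀ (by decide)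
  have h1 : coeff 1 (V₀.map PadicInt.Coe.ringHom).formalLog = 1 := WeierstrassCurve.coeff_one_formalLog _
  obtain ⟨hD, htrace, -⟩ := isDescendedFrobeniusMatrix_of_transfer h3t h1 hT W M ⟨𝓜⟩ hM
  exact ⟨M, hD, by rw [htrace, htr]⟩

end Summit.BirchSwinnertonDyer.BirchSwinnertonDyer.Theorems.DescendedFrobeniusTransfer
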